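import Mathlib.Analysis.SpecialFunctions.Pow.Real
import Mathlib.Analysis.SpecialFunctions.Pow.Continuity
import Mathlib.Analysis.SpecialFunctions.Pow.Asymptotics
import Mathlib.Analysis.Normed.Group.Basic
import Mathlib.Analysis.SpecificLimits.Basic
import Mathlib.Tactic.Linarith
import Mathlib.Tactic.Positivity
import Mathlib.Tactic.FieldSimp
import Mathlib.Algebra.BigOperators.Field
import HarnessLib

/-!
# Least-pth minimax approximation and the Charalambous multiplier update (Antoniou–Lu, §8.3)

[AL07] = A. Antoniou, W.-S. Lu, *Practical Optimization* [AntoniouLu2007], Ch. 8 "Minimax Methods",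
§8.2 "Problem Formulation" ((8.1)–(8.5)) and §8.3 "Minimax Algorithms", pp. 203–209 (held copy
`book:antoniou2007-practical-optimization`, read).

For sampled error values `e = (e₁, …, e_K)` the minimax objective is `Ê = max_i |e_i|` ((8.5),
(8.6c)); the *least-pth* device replaces it by the `L_p` norm `Ψ_p = [Σ_i |e_i|^p]^{1/p}`, which tends
to `Ê` as `p → ∞` (display before (8.6a)) and factors as `Ψ_p = Ê·{Σ_i (|e_i|/Ê)^p}^{1/p}` when
`Ê > 0` ((8.6a)); Algorithm 8.1 minimises `Ψ_p` for `p = 2, 4, 8, …` (`p ← μp`, Step 4).  The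
Charalambous algorithm (Algorithm 8.2) instead updates multipliers: with `φ_i = |e_i| − ξ`, Step 4
sets `λ⁺_i = λ_iφ_i/Φ` on `I₁ = {φ_i > 0, λ_i > 0}`, `φ_i/Φ` on `I₂ = {φ_i > 0, λ_i = 0}`, `0` on
`I₃ = {φ_i ≤ 0}`, `Φ` = the sum of the numerators, and Step 5 sets `ξ⁺ = Σ_i λ⁺_i |e_i|`, "a lower
bound of the minimum of Ê(x) [which] approaches Ê from below".

Rendering: `Ê` is the sup norm `‖e‖` of `e : ι → ℝ` (Mathlib's Pi norm, `= max_i |e_i|`,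
attained: `exists_Ehat_eq_abs`; the bound `|e_i| ≤ Ê` is Mathlib's `norm_le_pi_norm`, used
inline); `Psi p e` is the least-pth objective.  Proved: the sandwich
`Ê ≤ Ψ_p ≤ K^{1/p}Ê` (`Ehat_le_Psi`, `Psi_le`), the factorisation (8.6a) (`Psi_factor`), the limit
`Ψ_p → Ê` (`Psi_tendsto_Ehat`) and along Algorithm 8.1's exponents `p_k = 2μ^k → ∞`
(`leastPth_exponent_tendsto`, `Psi_leastPth_tendsto`); for Algorithm 8.2 the updated multipliers
are a probability vector (`charalambousWeight_nonneg`, `charalambousWeight_sum`) and hence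
`ξ⁺ ≤ Ê` (`xi_le_Ehat`).

Published results only (Lean placement rule): every public declaration carries its
`[cite: AntoniouLu2007, §8.3 …]` locator.
-/

namespace Literature.Analysis.Convex.LeastPthMinimax

open Filter Topology Finset

variable {ι : Type*} [Fintype ι]

/-- The least-pth objective `Ψ_p(e) = [Σ_i |e_i|^p]^{1/p}`. [cite: AntoniouLu2007, §8.3 (display
before (8.6a)), (8.6a)] -/
noncomputable def Psi (p : ℝ) (e : ι → ℝ) : ℝ := (∑ i, |e i| ^ p) ^ (1 / p)

/-- `Ê = max_i |e_i|` (here `Ê = ‖e‖`, the sup norm) is attained: `Ê = |e_i|` for some `i`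
(nonempty sample set).  The domination `|e_i| ≤ Ê` is the tree's
`B5SupCommutator128.abs_apply_le_norm` / Mathlib's `norm_le_pi_norm` and is used inline below,
not restated. [cite: AntoniouLu2007, §8.3 (8.6c)] -/
theorem exists_Ehat_eq_abs [Nonempty ι] (e : ι → ℝ) : ∃ i, ‖e‖ = |e i| := by
  obtain ⟨i, -, hi⟩ := Finset.exists_mem_eq_sup (Finset.univ : Finset ι) Finset.univ_nonempty
    fun b => ‖e b‖₊
  refine ⟨i, ?_⟩
  rw [Pi.norm_def, hi, coe_nnnorm, Real.norm_eq_abs]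

/-- `Ψ_p ≥ 0`. [cite: AntoniouLu2007, §8.3 (8.6a)] -/
theorem Psi_nonneg (p : ℝ) (e : ι → ℝ) : 0 ≤ Psi p e :=
  Real.rpow_nonneg (Finset.sum_nonneg fun _ _ => Real.rpow_nonneg (abs_nonneg _) _) _

/-- **Lower sandwich:** `Ê ≤ Ψ_p` for `p > 0` (each `|e_i| = (|e_i|^p)^{1/p} ≤ Ψ_p`).
[cite: AntoniouLu2007, §8.3 (limit display before (8.6a))] -/
theorem Ehat_le_Psi {p : ℝ} (hp : 0 < p) (e : ι → ℝ) : ‖e‖ ≤ Psi p e := by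
  rw [pi_norm_le_iff_of_nonneg (Psi_nonneg p e)]
  intro i
  rw [Real.norm_eq_abs, Psi]
  have h1 : |e i| = (|e i| ^ p) ^ (1 / p) := by
    rw [one_div, Real.rpow_rpow_inv (abs_nonneg _) hp.ne']
  rw [h1]
  refine Real.rpow_le_rpow (Real.rpow_nonneg (abs_nonneg _) _) ?_ (by positivity)
  exact Finset.single_le_sum (f := fun j => |e j| ^ p)
    (fun j _ => Real.rpow_nonneg (abs_nonneg _) _) (Finset.mem_univ i)

/-- **Upper sandwich:** `Ψ_p ≤ K^{1/p} Ê` for `p > 0`, `K` = the number of samples.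
[cite: AntoniouLu2007, §8.3 (limit display before (8.6a))] -/
theorem Psi_le {p : ℝ} (hp : 0 < p) (e : ι → ℝ) :
    Psi p e ≤ (Fintype.card ι : ℝ) ^ (1 / p) * ‖e‖ := by
  have hsum : ∑ i, |e i| ^ p ≤ (Fintype.card ι : ℝ) * ‖e‖ ^ p := by
    calc ∑ i, |e i| ^ p ≤ ∑ _i : ι, ‖e‖ ^ p :=
          Finset.sum_le_sum fun i _ =>
            Real.rpow_le_rpow (abs_nonneg _)
              ((Real.norm_eq_abs (e i)).symm.trans_le (norm_le_pi_norm e i)) hp.le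
      _ = (Fintype.card ι : ℝ) * ‖e‖ ^ p := by simp
  calc Psi p e ≤ ((Fintype.card ι : ℝ) * ‖e‖ ^ p) ^ (1 / p) :=
        Real.rpow_le_rpow (Finset.sum_nonneg fun i _ => Real.rpow_nonneg (abs_nonneg _) _) hsum
          (by positivity)
    _ = (Fintype.card ι : ℝ) ^ (1 / p) * ‖e‖ := by
        rw [Real.mul_rpow (by positivity) (by positivity), one_div,
          Real.rpow_rpow_inv (norm_nonneg _) hp.ne']

/-- **(8.6a).** If `Ê > 0` then `Ψ_p = Ê·{Σ_i (|e_i|/Ê)^p}^{1/p}`.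
[cite: AntoniouLu2007, §8.3 (8.6a)–(8.6c)] -/
theorem Psi_factor {p : ℝ} (hp : 0 < p) {e : ι → ℝ} (hE : 0 < ‖e‖) :
    Psi p e = ‖e‖ * (∑ i, (|e i| / ‖e‖) ^ p) ^ (1 / p) := by
  have hsum : ∑ i, |e i| ^ p = ‖e‖ ^ p * ∑ i, (|e i| / ‖e‖) ^ p := by
    rw [Finset.mul_sum]
    refine Finset.sum_congr rfl fun i _ => ?_
    rw [← Real.mul_rpow hE.le (div_nonneg (abs_nonneg _) hE.le), mul_div_cancel₀ _ hE.ne']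
  rw [Psi, hsum, Real.mul_rpow (by positivity) (Finset.sum_nonneg fun i _ => by positivity),
    one_div, Real.rpow_rpow_inv hE.le hp.ne']

omit [Fintype ι] in
/-- `c^{1/p} → 1` as `p → ∞` for a constant `c > 0` (used for `K^{1/p}`).
[cite: AntoniouLu2007, §8.3 (limit display before (8.6a))] -/
theorem const_rpow_inv_tendsto_one {c : ℝ} (hc : 0 < c) :
    Tendsto (fun p : ℝ => c ^ (1 / p)) atTop (𝓝 1) := by
  have h1 : Tendsto (fun p : ℝ => 1 / p) atTop (𝓝 0) := by
    simpa only [one_div] using tendsto_inv_atTop_zero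
  have h2 : Tendsto (fun q : ℝ => c ^ q) (𝓝 0) (𝓝 (c ^ (0 : ℝ))) :=
    (Real.continuousAt_const_rpow hc.ne').tendsto
  rw [Real.rpow_zero] at h2
  exact h2.comp h1

/-- **`lim_{p→∞} Ψ_p = ‖e‖_∞ = max_i |e_i| = Ê`.** [cite: AntoniouLu2007, §8.3 (limit display
before (8.6a))] -/
theorem Psi_tendsto_Ehat (e : ι → ℝ) : Tendsto (fun p => Psi p e) atTop (𝓝 ‖e‖) := by
  have hlow : ∀ᶠ p in atTop, ‖e‖ ≤ Psi p e :=
    (eventually_gt_atTop 0).mono fun p hp => Ehat_le_Psi hp e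
  have hup : ∀ᶠ p in atTop, Psi p e ≤ (Fintype.card ι : ℝ) ^ (1 / p) * ‖e‖ :=
    (eventually_gt_atTop 0).mono fun p hp => Psi_le hp e
  rcases isEmpty_or_nonempty ι with hι | hι
  · have he : ‖e‖ = 0 := by
      have : e = 0 := funext fun i => (hι.false i).elim
      rw [this, norm_zero]
    refine tendsto_of_tendsto_of_tendsto_of_le_of_le' tendsto_const_nhds ?_ hlow hup
    rw [he]; simp
  · have hK : (0 : ℝ) < Fintype.card ι := by exact_mod_cast Fintype.card_pos
    have hlim : Tendsto (fun p : ℝ => (Fintype.card ι : ℝ) ^ (1 / p) * ‖e‖) atTop (𝓝 ‖e‖) := by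
      have := (const_rpow_inv_tendsto_one hK).mul_const ‖e‖
      rwa [one_mul] at this
    exact tendsto_of_tendsto_of_tendsto_of_le_of_le' tendsto_const_nhds hlim hlow hup

omit [Fintype ι] in
/-- **Algorithm 8.1, Step 4:** the exponents `p_k = 2μ^k` (`p = 2`, then `p ← μp`, `μ ≥ 2` an
integer; "a value of 2 gives good results") tend to `∞`. [cite: AntoniouLu2007, §8.3 Algorithm 8.1
Steps 1 and 4] -/
theorem leastPth_exponent_tendsto {μ : ℝ} (hμ : 1 < μ) :
    Tendsto (fun k : ℕ => 2 * μ ^ k) atTop atTop :=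
  (tendsto_pow_atTop_atTop_of_one_lt hμ).const_mul_atTop (by norm_num)

/-- **Algorithm 8.1 (principle):** along `p_k = 2μ^k` the least-pth objectives converge to the
minimax objective, `Ψ_{p_k}(e) → Ê(e)` ("by minimizing Ψ_k for increasing power of p, the
minimization of the L_∞ norm of e can be achieved"). [cite: AntoniouLu2007, §8.3 (sentence after
the limit display); Algorithm 8.1] -/
theorem Psi_leastPth_tendsto (e : ι → ℝ) {μ : ℝ} (hμ : 1 < μ) :
    Tendsto (fun k : ℕ => Psi (2 * μ ^ k) e) atTop (𝓝 ‖e‖) :=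
  (Psi_tendsto_Ehat e).comp (leastPth_exponent_tendsto hμ)

/-- The numerator of the Charalambous update (Algorithm 8.2, Step 4): `λ_iφ_i` on
`I₁ = {φ_i > 0, λ_i > 0}`, `φ_i` on `I₂ = {φ_i > 0, λ_i = 0}`, `0` on `I₃ = {φ_i ≤ 0}` (for `λ ≥ 0`).
[cite: AntoniouLu2007, §8.3 Algorithm 8.2 Step 4, (8.9a)–(8.9b)] -/
noncomputable def charalambousNumer (lam φ : ι → ℝ) (i : ι) : ℝ :=
  if 0 < φ i then (if 0 < lam i then lam i * φ i else φ i) else 0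

/-- `Φ_k = Σ_{I₁} λ_iφ_i + Σ_{I₂} φ_i` = the sum of the numerators.
[cite: AntoniouLu2007, §8.3 Algorithm 8.2 Step 4 (Φ_k)] -/
noncomputable def charalambousPhi (lam φ : ι → ℝ) : ℝ := ∑ i, charalambousNumer lam φ i

/-- The updated multipliers `λ_{(k+1)i}` = numerator `/ Φ_k`.
[cite: AntoniouLu2007, §8.3 Algorithm 8.2 Step 4] -/
noncomputable def charalambousWeight (lam φ : ι → ℝ) (i : ι) : ℝ :=
  charalambousNumer lam φ i / charalambousPhi lam φ

omit [Fintype ι] in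
/-- Each numerator is `≥ 0`. [cite: AntoniouLu2007, §8.3 Algorithm 8.2 Step 4] -/
theorem charalambousNumer_nonneg (lam φ : ι → ℝ) (i : ι) : 0 ≤ charalambousNumer lam φ i := by
  unfold charalambousNumer
  split_ifs with h1 h2
  · exact (mul_pos h2 h1).le
  · exact h1.le
  · exact le_rfl

/-- `Φ_k > 0` as soon as some `φ_i > 0` (some sample exceeds the level `ξ`).
[cite: AntoniouLu2007, §8.3 Algorithm 8.2 Step 4] -/
theorem charalambousPhi_pos (lam φ : ι → ℝ) {j : ι} (hj : 0 < φ j) : 0 < charalambousPhi lam φ := by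
  unfold charalambousPhi
  refine lt_of_lt_of_le ?_ (Finset.single_le_sum (fun i _ => charalambousNumer_nonneg lam φ i)
    (Finset.mem_univ j))
  unfold charalambousNumer
  rw [if_pos hj]
  split_ifs with h2
  · exact mul_pos h2 hj
  · exact hj

/-- The updated multipliers are `≥ 0`. [cite: AntoniouLu2007, §8.3 Algorithm 8.2 Step 4] -/
theorem charalambousWeight_nonneg (lam φ : ι → ℝ) {j : ι} (hj : 0 < φ j) (i : ι) :
    0 ≤ charalambousWeight lam φ i :=
  div_nonneg (charalambousNumer_nonneg lam φ i) (charalambousPhi_pos lam φ hj).le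

/-- … and sum to one: `Σ_i λ_{(k+1)i} = 1` (division by `Φ_k` normalises).
[cite: AntoniouLu2007, §8.3 Algorithm 8.2 Step 4] -/
theorem charalambousWeight_sum (lam φ : ι → ℝ) {j : ι} (hj : 0 < φ j) :
    ∑ i, charalambousWeight lam φ i = 1 := by
  unfold charalambousWeight
  rw [← Finset.sum_div]
  exact div_self (charalambousPhi_pos lam φ hj).ne'

/-- **Step 5: `ξ_{k+1} = Σ_i λ_{(k+1)i}|e_i| ≤ Ê`** — a convex combination of the `|e_i|` cannot exceed
their maximum ("constant ξ is a lower bound … approaches Ê(x̌) from below").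
[cite: AntoniouLu2007, §8.3 Algorithm 8.2 Step 5 and the paragraph after (8.11)] -/
theorem xi_le_Ehat (lam φ e : ι → ℝ) {j : ι} (hj : 0 < φ j) :
    ∑ i, charalambousWeight lam φ i * |e i| ≤ ‖e‖ := by
  calc ∑ i, charalambousWeight lam φ i * |e i| ≤ ∑ i, charalambousWeight lam φ i * ‖e‖ :=
        Finset.sum_le_sum fun i _ =>
          mul_le_mul_of_nonneg_left
            ((Real.norm_eq_abs (e i)).symm.trans_le (norm_le_pi_norm e i))
            (charalambousWeight_nonneg lam φ hj i)
    _ = ‖e‖ := by rw [← Finset.sum_mul, charalambousWeight_sum lam φ hj, one_mul]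

end Literature.Analysis.Convex.LeastPthMinimax
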